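import Mathlib
import Summits.QuantumFields.QCD.Theorems.QuarksAsStableActionUnquenchedChessboardBoundLinkGramFinalAux
import HarnessLib

/-!
# Link Gram identity, part 9c: `stub_linkGram` (crux stmt-QuantumFields-9735, line `Sketch`)

The link-reflection Cauchy–Schwarz inequality of the peeling recursion, in the temporal gauge:
`0 ≤ Re Zc(F)` and `|Zc(A)|² ≤ Re Zc(F) · Re Zc(∅)` for the symmetric slab `F = slabBonds (-p) (2p+1)`
and its upper half `A = slabBonds 1 p` (`L` even, `4 ≤ L`, `2p+1 ≤ L/2`, `β ≥ 0`, masses `> -1`).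
Proof: parts 1–9b express the three integrals as `K₀ Σ_κ W_κ B(Φ_κ,Φ_κ)`, `K₀ C B(1,Φ_{κ₀})`,
`K₀ C² B(1,1)` for the reflection-positive Hermitian form `B = linkForm β` (`K₀ ≥ 0`, `C` real,
`W_κ ∈ {0,1}`); the Gram Cauchy–Schwarz inequality `norm_sum_form_sq_le` with the families
`ψ_κ = W_κ Φ_κ`, `φ_κ = δ_{κκ₀} C` finishes. All statements are proved.
-/

noncomputable section

open MeasureTheory Matrix Complex Finset
open Literature.MathematicalPhysics.QuantumFieldTheory Literature.MathematicalPhysics.QuantumLattice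
open Literature.Probability.LatticeModels (TorusSite)
open Summit.QuantumFields.QCD.Theorems.QuarksAsStableAction
open scoped ComplexConjugate BigOperators ComplexOrder

namespace Summit.QuantumFields.QCD.Theorems.UnquenchedChessboardBoundLine

/-- The final arithmetic: scaling a Cauchy–Schwarz triple by a non-negative real constant. -/
theorem linkGram_final_ineq (k : ℝ) (hk : 0 ≤ k) (XA X0 Xf : ℂ) (hf : 0 ≤ Xf.re)
    (hcs : ‖XA‖ ^ 2 ≤ X0.re * Xf.re) :
    0 ≤ ((k : ℂ) * Xf).re ∧ ‖(k : ℂ) * XA‖ ^ 2 ≤ ((k : ℂ) * Xf).re * ((k : ℂ) * X0).re := by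
  simp only [Complex.re_ofReal_mul, norm_mul, Complex.norm_real, Real.norm_eq_abs, abs_of_nonneg hk,
    mul_pow]
  refine ⟨mul_nonneg hk hf, ?_⟩
  have h0 : 0 ≤ X0.re * Xf.re := (sq_nonneg _).trans hcs
  nlinarith [mul_le_mul_of_nonneg_left hcs (sq_nonneg k)]

variable {L : ℕ} [NeZero L] [Fact (1 < L)]

omit [Fact (1 < L)] in
/-- Constants are admissible. -/
theorem linkAdm_const {N : ℕ} (c : ℂ) :
    Measurable (fun _ : GaugeConfig 4 L (Matrix.specialUnitaryGroup (Fin N) ℂ) => c) ∧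
      (∃ K : ℝ, ∀ U : GaugeConfig 4 L (Matrix.specialUnitaryGroup (Fin N) ℂ), ‖(fun _ => c) U‖ ≤ K) ∧
      DependsOn (fun _ : GaugeConfig 4 L (Matrix.specialUnitaryGroup (Fin N) ℂ) => c)
        ((WilsonRP.posEdges : Finset (Edge 4 L)) : Set (Edge 4 L)) :=
  ⟨measurable_const, ⟨‖c‖, fun _ => le_rfl⟩, fun _ _ _ => rfl⟩

omit [Fact (1 < L)] in
/-- Admissible functions are closed under constant multiples. -/
theorem linkAdm_const_mul {N : ℕ} (a : ℂ) {Φ : GaugeConfig 4 L (Matrix.specialUnitaryGroup (Fin N) ℂ) → ℂ}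
    (hΦ : Measurable Φ ∧ (∃ K : ℝ, ∀ U, ‖Φ U‖ ≤ K) ∧
      DependsOn Φ ((WilsonRP.posEdges : Finset (Edge 4 L)) : Set (Edge 4 L))) :
    Measurable (fun U => a * Φ U) ∧ (∃ K : ℝ, ∀ U, ‖(fun U => a * Φ U) U‖ ≤ K) ∧
      DependsOn (fun U => a * Φ U) ((WilsonRP.posEdges : Finset (Edge 4 L)) : Set (Edge 4 L)) := by
  obtain ⟨h1, ⟨K, hK⟩, h3⟩ := hΦ
  refine ⟨h1.const_mul a, ⟨‖a‖ * K, fun U => ?_⟩, fun U V hUV => ?_⟩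
  · simp only [norm_mul]
    exact mul_le_mul_of_nonneg_left (hK U) (norm_nonneg _)
  · simp only [h3 hUV]

/-- **`stub_linkGram`** (registered stub of crux stmt-QuantumFields-9735, line `Sketch`): the link
reflection-positivity Cauchy–Schwarz inequality in the temporal gauge. -/
theorem stub_linkGram (Nf L : ℕ) [NeZero L] [Fact (1 < L)] (hL : Even L) (h4 : 4 ≤ L) (β : ℝ) (hβ : 0 ≤ β)
    (m : Fin Nf → ℝ) (hm : ∀ f, -1 < m f) (p : ℕ) (hp : 2 * p + 1 ≤ L / 2) :
    0 ≤ (∫ U, (∏ f, (bondWilsonDiracAP (slabBonds (-(p : ZMod L)) (2 * p + 1)) (LatticeRP.splice WilsonRP.crossEdges (U, 1)) (m f)).det) *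
            (Real.exp (-β * wilsonAction (fundamentalRep (Fin 3)) (LatticeRP.splice WilsonRP.crossEdges (U, 1))) : ℂ)
          ∂(Measure.pi fun _ : Edge 4 L => haarProbability (Matrix.specialUnitaryGroup (Fin 3) ℂ))).re ∧
      ‖∫ U, (∏ f, (bondWilsonDiracAP (slabBonds 1 p) (LatticeRP.splice WilsonRP.crossEdges (U, 1)) (m f)).det) *
            (Real.exp (-β * wilsonAction (fundamentalRep (Fin 3)) (LatticeRP.splice WilsonRP.crossEdges (U, 1))) : ℂ)
          ∂(Measure.pi fun _ : Edge 4 L => haarProbability (Matrix.specialUnitaryGroup (Fin 3) ℂ))‖ ^ 2 ≤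
        (∫ U, (∏ f, (bondWilsonDiracAP (slabBonds (-(p : ZMod L)) (2 * p + 1)) (LatticeRP.splice WilsonRP.crossEdges (U, 1)) (m f)).det) *
            (Real.exp (-β * wilsonAction (fundamentalRep (Fin 3)) (LatticeRP.splice WilsonRP.crossEdges (U, 1))) : ℂ)
          ∂(Measure.pi fun _ : Edge 4 L => haarProbability (Matrix.specialUnitaryGroup (Fin 3) ℂ))).re *
        (∫ U, (∏ f, (bondWilsonDiracAP ∅ (LatticeRP.splice WilsonRP.crossEdges (U, 1)) (m f)).det) *
            (Real.exp (-β * wilsonAction (fundamentalRep (Fin 3)) (LatticeRP.splice WilsonRP.crossEdges (U, 1))) : ℂ)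
          ∂(Measure.pi fun _ : Edge 4 L => haarProbability (Matrix.specialUnitaryGroup (Fin 3) ℂ))).re := by
  have hpL := two_mul_add_two_lt h4 hp
  rw [integral_full_slab h4 hL hβ p hp m, integral_upper_slab h4 hL hβ p hp m,
    integral_empty_slab h4 hL hβ p hp m]
  -- the constants are real, `K₀ ≥ 0`
  set R := Fintype.card {i : TorusSite 4 L × Fin 3 × Fin 4 //
    ¬ (i.1 ∈ linkUpSites p ∨ Site.timeReflect i.1 ∈ linkUpSites p)} with hR
  set n := linkUpCard L 3 p with hn
  set F := slabBonds (-(p : ZMod L)) (2 * p + 1) with hF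
  have hK₀ : ((Real.exp (-β * ((3 : ℕ) * Fintype.card (Plaquette 4 L))) : ℝ) : ℂ) *
      ∏ f, ((m f + 4 * 1 : ℝ) : ℂ) ^ R =
      ((Real.exp (-β * ((3 : ℕ) * Fintype.card (Plaquette 4 L))) * ∏ f, (m f + 4 * 1) ^ R : ℝ) : ℂ) := by
    push_cast; rfl
  have hk : 0 ≤ Real.exp (-β * ((3 : ℕ) * Fintype.card (Plaquette 4 L))) * ∏ f, (m f + 4 * 1) ^ R :=
    mul_nonneg (Real.exp_nonneg _) (Finset.prod_nonneg fun f _ => pow_nonneg (by linarith [hm f]) _)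
  set c : ℝ := ∏ f, (m f + 4 * 1) ^ n with hc
  have hC : (∏ f, ((m f + 4 * 1 : ℝ) : ℂ) ^ n) = (c : ℂ) := by rw [hc]; push_cast; rfl
  rw [hK₀, hC]
  -- the form and the admissible class
  let B : (GaugeConfig 4 L (Matrix.specialUnitaryGroup (Fin 3) ℂ) → ℂ) →
      (GaugeConfig 4 L (Matrix.specialUnitaryGroup (Fin 3) ℂ) → ℂ) → ℂ := fun Φ Ψ => linkForm β Φ Ψ
  let Adm : (GaugeConfig 4 L (Matrix.specialUnitaryGroup (Fin 3) ℂ) → ℂ) → Prop := fun Φ =>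
    Measurable Φ ∧ (∃ K : ℝ, ∀ U, ‖Φ U‖ ≤ K) ∧
      DependsOn Φ ((WilsonRP.posEdges : Finset (Edge 4 L)) : Set (Edge 4 L))
  have hpos : ∀ Φ, Adm Φ → 0 ≤ B Φ Φ := fun Φ ⟨h1, ⟨K, hK⟩, h3⟩ => linkForm_self_nonneg hL hβ h1 hK h3
  have hherm : ∀ Φ Ψ, Adm Φ → Adm Ψ → B Ψ Φ = conj (B Φ Ψ) :=
    fun Φ Ψ hΦ hΨ => linkForm_conj_symm hL β hΦ.1 hΨ.1
  have hadd : ∀ Φ Ψ (t : ℂ), Adm Φ → Adm Ψ →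
      B (Φ + t • Ψ) (Φ + t • Ψ) = B Φ Φ + conj t * B Ψ Φ + t * B Φ Ψ + conj t * t * B Ψ Ψ := by
    intro Φ Ψ t hΦ hΨ
    obtain ⟨KΦ, hKΦ⟩ := hΦ.2.1
    obtain ⟨KΨ, hKΨ⟩ := hΨ.2.1
    exact linkForm_add_smul hβ t hΦ.1 hΨ.1 hKΦ hKΨ
  have hadm : ∀ Φ Ψ (t : ℂ), Adm Φ → Adm Ψ → Adm (Φ + t • Ψ) := fun Φ Ψ t hΦ hΨ => linkAdm_add_smul t hΦ hΨ
  -- the two families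
  let κ₀ : Fin Nf → Finset (Fin n) × Finset (Fin n) := fun _ => (∅, ∅)
  let ψ : (Fin Nf → Finset (Fin n) × Finset (Fin n)) → GaugeConfig 4 L (Matrix.specialUnitaryGroup (Fin 3) ℂ) → ℂ :=
    fun κ U => linkWt L 3 p κ * linkFeat p F m κ U
  let φ : (Fin Nf → Finset (Fin n) × Finset (Fin n)) → GaugeConfig 4 L (Matrix.specialUnitaryGroup (Fin 3) ℂ) → ℂ :=
    fun κ U => (if κ = κ₀ then (c : ℂ) else 0) * (fun _ => (1 : ℂ)) U
  have hψ : ∀ κ, Adm (ψ κ) := fun κ => linkAdm_const_mul _ (linkFeat_adm p (by omega) hpL F m κ)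
  have hφ : ∀ κ, Adm (φ κ) := fun κ => linkAdm_const_mul _ (linkAdm_const 1)
  have hcs := norm_sum_form_sq_le B Adm hpos hherm hadd hadm φ ψ hφ hψ
  have hf0 := re_sum_form_nonneg B Adm hpos ψ hψ
  -- evaluation of the three Gram sums
  have hWt0 : linkWt L 3 p κ₀ = 1 := Finset.prod_eq_one fun f _ => linkWeight_empty p
  have hWt2 : ∀ κ : Fin Nf → Finset (Fin n) × Finset (Fin n),
      linkWt L 3 p κ * conj (linkWt L 3 p κ) = linkWt L 3 p κ := fun κ => by
    rcases linkWt_eq_zero_or_one p κ with h | h <;> simp [h]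
  have hS1 : ∑ κ, B (φ κ) (ψ κ) = (c : ℂ) * linkForm β (fun _ => 1) (linkFeat p F m κ₀) := by
    rw [Finset.sum_eq_single κ₀]
    · show linkForm β (fun U => (if κ₀ = κ₀ then (c : ℂ) else 0) * (fun _ => (1 : ℂ)) U)
        (fun U => linkWt L 3 p κ₀ * linkFeat p F m κ₀ U) = _
      rw [linkForm_scale, if_pos rfl, hWt0, Complex.conj_ofReal, one_mul]
    · intro κ _ hκ
      show linkForm β (fun U => (if κ = κ₀ then (c : ℂ) else 0) * (fun _ => (1 : ℂ)) U)
        (fun U => linkWt L 3 p κ * linkFeat p F m κ U) = 0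
      rw [linkForm_scale, if_neg hκ, map_zero, mul_zero, zero_mul]
    · intro h; exact absurd (Finset.mem_univ κ₀) h
  have hS2 : ∑ κ, B (φ κ) (φ κ) = (c : ℂ) * (c : ℂ) * linkForm β
      (fun _ : GaugeConfig 4 L (Matrix.specialUnitaryGroup (Fin 3) ℂ) => (1 : ℂ)) (fun _ => 1) := by
    rw [Finset.sum_eq_single κ₀]
    · show linkForm β (fun U => (if κ₀ = κ₀ then (c : ℂ) else 0) * (fun _ => (1 : ℂ)) U)
        (fun U => (if κ₀ = κ₀ then (c : ℂ) else 0) * (fun _ => (1 : ℂ)) U) = _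
      rw [linkForm_scale, if_pos rfl, Complex.conj_ofReal]
    · intro κ _ hκ
      show linkForm β (fun U => (if κ = κ₀ then (c : ℂ) else 0) * (fun _ => (1 : ℂ)) U)
        (fun U => (if κ = κ₀ then (c : ℂ) else 0) * (fun _ => (1 : ℂ)) U) = 0
      rw [linkForm_scale, if_neg hκ, map_zero, mul_zero, zero_mul]
    · intro h; exact absurd (Finset.mem_univ κ₀) h
  have hS3 : ∑ κ, B (ψ κ) (ψ κ) = ∑ κ, linkWt L 3 p κ * linkForm β (linkFeat p F m κ) (linkFeat p F m κ) := by
    refine Finset.sum_congr rfl fun κ _ => ?_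
    show linkForm β (fun U => linkWt L 3 p κ * linkFeat p F m κ U) (fun U => linkWt L 3 p κ * linkFeat p F m κ U) = _
    rw [linkForm_scale, hWt2]
  rw [hS1, hS2, hS3] at hcs
  rw [hS3] at hf0
  exact linkGram_final_ineq _ hk _ _ _ hf0 hcs

end Summit.QuantumFields.QCD.Theorems.UnquenchedChessboardBoundLine

end
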